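import Summits.RiemannHypothesis.RiemannHypothesis.Theorems.Splittings.BombieriTruncMultiplicity
import Summits.RiemannHypothesis.RiemannHypothesis.Theorems.Splittings.BombieriCorollaryProvenance
import Literature.NumberTheory.LFunctions.CramerMeanSquareAsymptoticRH

/-!
# Splittings — x-wuc (xiv-b3): SZC-FREE band gap `m_N(ρ)·(Re ρ − ½)² ≥ c/16`, the ZERO-FREE CUSP from B′([−1,1]) alone, and row X-5 `RH ⟺ ES_m ∧ B′([−1,1])` modulo `Corollary11Prov`

Cell rh-split, seat rh-split-x-wuc g5 (brief sha16 f79c5f09d8bcb036), card `run/shared/lean/pub/rh-split/cards/SPLIT-x-wuc.md` §11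
(referee rh-split-ref g3 2026-08-27T06:23:10Z: REPLAY PASS of the scratch `HOME/rh-split-x-wuc/SplitXWucG5.lean`; lead RULING #35:
cut (xiv)).  Carved VERBATIM from that scratch (file of record sha16 66b013c38c58c722); sections as numbered there.
* §11 `exists_negRoot_of_screening_mult`, `classVec`, `gap_of_boundedAway_level_mult`, `card_fib_le_order`, `zeroFreeRegion_of_boundedAway`
  (`B′([−1,1]) → ∃ c′ > 0, ∀ off-line ρ, c′ ≤ log(|Im ρ|+2)·(Re ρ − ½)²`, tree `CramerMeanSquare.exists_order_le_log`), `EventualStripMult` (ES_m),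
  `foz_of_eventualStripMult_of_boundedAway`, `rh_iff_eventualStripMult_and_boundedAway` (hypothesis-explicit);
* §13 rows of record modulo the tree's named print fact ONLY: `rh_iff_eventualStripMult_and_boundedAway_prov : Corollary11Prov →
  (RH ↔ EventualStripMult ∧ B′([−1,1]))`, `boundedAway_one_iff_rh_of_eventualStripMult`.  LABEL: class-(a) CONDITIONAL BOOKKEEPING exactly as
  row C5 (`BombieriCorollaryProvenance`); both conjuncts RH-implied and open; not a survivor.
HONEST LABEL: «SPLITTING SEARCH over kernel-typed RH-EQUIVALENCES; a splitting A ∧ B ⟹ RH is CONDITIONAL bookkeeping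
unless A and B are both proved; nothing here bears on the truth of RH.»
-/

set_option linter.dupNamespace false

noncomputable section

open scoped Classical ComplexConjugate
open Set Filter Topology Complex MeasureTheory

namespace Summit.RiemannHypothesis.RiemannHypothesis.Theorems.Splittings.BombieriTruncEventualStrip

open Literature.NumberTheory.LFunctions Literature.NumberTheory.LFunctions.Bombieri2000
open Summit.RiemannHypothesis.RiemannHypothesis.Theses.RuelleBand
open Summit.RiemannHypothesis.RiemannHypothesis.Theorems.Splittings.BombieriTruncEigen
open Summit.RiemannHypothesis.RiemannHypothesis.Theorems.Splittings.BombieriFozNoDep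
open Summit.RiemannHypothesis.RiemannHypothesis.Theorems.Splittings.BombieriTruncGram
open Summit.RiemannHypothesis.RiemannHypothesis.Theorems.Splittings.BombieriTruncPairing
open Summit.RiemannHypothesis.RiemannHypothesis.Theorems.Splittings.BombieriTruncScreening
open Summit.RiemannHypothesis.RiemannHypothesis.Theorems.Splittings.BombieriTruncBandGap
open Summit.RiemannHypothesis.RiemannHypothesis.Theorems.Splittings.BombieriTruncMultiplicity

variable {E : Set ℝ} {N : ℕ}

/-! ## §11 SZC-free screening: class vectors, the band gap WITH MULTIPLICITY, a zero-free region from `B′`,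
and row X-5 `RH ⟺ ES_m ∧ B′([−1,1])` with NO simplicity hypothesis

The screening vector of an off-line multiplicity class `p` (all `m` slots of `ρ` minus all `m` slots of `1 − ρ̄`)
is class-constant, costs `≤ 32 m² κ²` on `[−1,1]` and pairs to `−2m`: the budget per class is `2/m`, so `B′` at
level `N` forces `m_N(ρ) · κ(ρ)² ≥ c/16` for every off-line zero in the window (`m_N ≤ m(ρ)`), whence with
`m(ρ) ≪ log |γ|` (tree `exists_order_le_log`, MV Thm 10.13) the ZERO-FREE REGION `|Re ρ − ½| ≥ c′/√log(|γ|+2)` off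
the line, and FOZ as soon as the multiplicity-weighted eventual strip `ES_m` holds. -/

/-- **(K2-mult)** screening by a class-constant vector on a window `[−a, a]` — no simplicity hypothesis. [new] -/
theorem exists_negRoot_of_screening_mult {a : ℝ} (ha : 0 < a) {c : ℝ} (hc : 0 < c) {x : truncIdx N → ℂ}
    (hxL : x ∈ classSub N) (hx : ∫ u in Icc (-a) a, ‖F N x u‖ ^ 2 < c * -(pairing N x x).re) :
    ∃ μ ∈ (truncKMat (Icc (-a) a) N).charpoly.roots, μ.im = 0 ∧ -c < μ.re ∧ μ.re < 0 :=
  exists_negRoot_of_screening_sub (E := Icc (-a) a) subset_rfl (classSub N)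
    (fun _ hxL hx0 ↦ cost_pos_of_mem_classSub ha hxL hx0) avg avg_mem
    (fun v _ w ↦ gram_sub_avg_eq_zero subset_rfl v w) (fun _ hv w ↦ pairing_sub_avg_eq_zero hv w) hc hxL hx

/-- `tbar j ∈ fib (tbar i) ↔ j ∈ fib i`. -/
theorem tbar_mem_fib_iff {i j : truncIdx N} : tbar j ∈ fib (tbar i) ↔ j ∈ fib i := by
  rw [mem_fib, mem_fib]
  exact ⟨fun h ↦ by simpa only [tbar_tbar] using val_tbar_eq_of_val_eq h, val_tbar_eq_of_val_eq⟩

/-- The class of `tbar i` is the `tbar`-image of the class of `i`. -/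
theorem fib_tbar (i : truncIdx N) : fib (tbar i) = (fib i).map (tbarEquiv N).toEmbedding := by
  ext k
  rw [Finset.mem_map_equiv]
  show k ∈ fib (tbar i) ↔ tbar k ∈ fib i
  rw [← tbar_mem_fib_iff (i := i) (j := tbar k), tbar_tbar]

/-- Partner classes have equal size. -/
theorem card_fib_tbar (i : truncIdx N) : (fib (tbar i)).card = (fib i).card := by
  rw [fib_tbar, Finset.card_map]

/-- For an off-line index the partner carries a different zero. -/
theorem val_tbar_ne_val {i : truncIdx N} (h : (i : ZeroIdx).OffLine) :
    ((tbar i : truncIdx N) : ZeroIdx).val ≠ (i : ZeroIdx).val := by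
  intro hv
  rw [coe_tbar, ZeroIdx.val_bar] at hv
  have hre := congrArg Complex.re hv
  simp only [Complex.sub_re, Complex.one_re, Complex.conj_re] at hre
  exact h (by linarith)

/-- For an off-line index, its class and its partner's class are disjoint. -/
theorem not_mem_fib_tbar_of_mem {i j : truncIdx N} (h : (i : ZeroIdx).OffLine) (hj : j ∈ fib i) :
    j ∉ fib (tbar i) := fun hj' ↦
  val_tbar_ne_val h ((mem_fib.1 hj').symm.trans (mem_fib.1 hj))

/-- The class screening vector of the slot `i`: `+1` on the class of `ρ_i`, `−1` on the class of `1 − ρ̄_i`. -/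
def classVec (i : truncIdx N) : truncIdx N → ℂ :=
  fun j ↦ (if j ∈ fib i then 1 else 0) - (if j ∈ fib (tbar i) then 1 else 0)

/-- The class vector `𝟙_{fib i} − 𝟙_{fib (tbar i)}` is class-constant. -/
theorem classVec_mem (i : truncIdx N) : classVec i ∈ classSub N := by
  intro j j' h
  have h1 : j ∈ fib i ↔ j' ∈ fib i := by rw [mem_fib, mem_fib, h]
  have h2 : j ∈ fib (tbar i) ↔ j' ∈ fib (tbar i) := by rw [mem_fib, mem_fib, h]
  simp only [classVec, h1, h2]

/-- Summing the exponential over one multiplicity class gives `#fib(i₀) · e^{−iγ_{i₀} u}`. -/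
theorem sum_ite_fib_mul_exp (i₀ : truncIdx N) (u : ℝ) :
    ∑ j : truncIdx N, (if j ∈ fib i₀ then (1 : ℂ) else 0) * cexp (-(I * (j : ZeroIdx).gamma * u)) =
      ((fib i₀).card : ℂ) * cexp (-(I * (i₀ : ZeroIdx).gamma * u)) := by
  simp only [ite_mul, one_mul, zero_mul]
  rw [Finset.sum_ite_mem, Finset.univ_inter]
  rw [Finset.sum_congr rfl fun j hj ↦ by rw [ZeroIdx.gamma, mem_fib.1 hj, ← ZeroIdx.gamma], Finset.sum_const,
    nsmul_eq_mul]

/-- `F_N (classVec i) = #fib(i) · F_N (pairVec i)`. -/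
theorem F_classVec (i : truncIdx N) (u : ℝ) :
    F N (classVec i) u = ((fib i).card : ℂ) * F N (pairVec i) u := by
  have hpv : F N (pairVec i) u =
      cexp (-(I * (i : ZeroIdx).gamma * u)) - cexp (-(I * ((tbar i : truncIdx N) : ZeroIdx).gamma * u)) := by
    rw [pairVec, F_sub, F_single, F_single]
  rw [hpv, F]
  simp only [classVec, sub_mul, Finset.sum_sub_distrib]
  rw [sum_ite_fib_mul_exp, sum_ite_fib_mul_exp, card_fib_tbar]
  ring

/-- Cost bound on `[−1, 1]`: `∫ ‖F_N (classVec i)‖² ≤ 32 · #fib(i)² · (Re ρ_i − ½)²`. -/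
theorem cost_classVec_le (i : truncIdx N) :
    ∫ u in Icc (-1 : ℝ) 1, ‖F N (classVec i) u‖ ^ 2 ≤
      32 * ((fib i).card : ℝ) ^ 2 * ((i : ZeroIdx).val.re - 1 / 2) ^ 2 := by
  have h : ∀ u, ‖F N (classVec i) u‖ ^ 2 = ((fib i).card : ℝ) ^ 2 * ‖F N (pairVec i) u‖ ^ 2 := by
    intro u
    rw [F_classVec, norm_mul, Complex.norm_natCast, mul_pow]
  simp_rw [h]
  rw [integral_const_mul]
  have h1 := cost_pairVec_le (E := Icc (-1 : ℝ) 1) subset_rfl i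
  calc ((fib i).card : ℝ) ^ 2 * ∫ u in Icc (-1 : ℝ) 1, ‖F N (pairVec i) u‖ ^ 2
      ≤ ((fib i).card : ℝ) ^ 2 * (32 * ((i : ZeroIdx).val.re - 1 / 2) ^ 2) :=
        mul_le_mul_of_nonneg_left h1 (by positivity)
    _ = _ := by ring

/-- For an off-line index, `pairing (classVec i) (classVec i) = −2 · #fib(i)`. -/
theorem pairing_classVec {i : truncIdx N} (h : (i : ZeroIdx).OffLine) :
    pairing N (classVec i) (classVec i) = -2 * (fib i).card := by
  have hterm : ∀ j : truncIdx N, conj (classVec i j) * classVec i (tbar j) =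
      -(if j ∈ fib i then (1 : ℂ) else 0) - (if j ∈ fib (tbar i) then (1 : ℂ) else 0) := by
    intro j
    by_cases h1 : j ∈ fib i
    · have h2 : j ∉ fib (tbar i) := not_mem_fib_tbar_of_mem h h1
      have h3 : tbar j ∈ fib (tbar i) := tbar_mem_fib_iff.2 h1
      have h4 : tbar j ∉ fib i := fun h4 ↦ h2 (by
        have h5 := (tbar_mem_fib_iff (i := i) (j := tbar j)).2 h4
        rwa [tbar_tbar] at h5)
      simp [classVec, h1, h2, h3, h4]
    · by_cases h2 : j ∈ fib (tbar i)
      · have h3 : tbar j ∈ fib i := by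
          have h5 := (tbar_mem_fib_iff (i := tbar i) (j := j)).2 h2
          rwa [tbar_tbar] at h5
        have h4 : tbar j ∉ fib (tbar i) := fun h4 ↦ h1 (tbar_mem_fib_iff.1 h4)
        simp [classVec, h1, h2, h3, h4]
      · simp [classVec, h1, h2]
  rw [pairing]
  simp_rw [hterm]
  rw [Finset.sum_sub_distrib, Finset.sum_neg_distrib, Finset.sum_ite_mem, Finset.sum_ite_mem, Finset.univ_inter,
    Finset.univ_inter, Finset.sum_const, Finset.sum_const, card_fib_tbar, nsmul_eq_mul, mul_one]
  ring

/-- **(K4-mult) band gap with multiplicity at one level — no simplicity hypothesis.** If every negative real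
eigenvalue of `𝒦_{[−1,1]}(Γ_N)` is `≤ −c`, every off-line slot `i ∈ Γ_N` satisfies `m_N(i) · (Re ρ_i − ½)² ≥ c/16`,
`m_N(i)` = the number of slots of `ρ_i` in `Γ_N` (`≤ m(ρ_i)`). [new] -/
theorem gap_of_boundedAway_level_mult {c : ℝ} (hc : 0 < c)
    (hB : ∀ μ ∈ (truncKMat (Icc (-1 : ℝ) 1) N).charpoly.roots, μ.im = 0 → μ.re < 0 → μ.re ≤ -c)
    (i : truncIdx N) (hi : (i : ZeroIdx).OffLine) :
    c / 16 ≤ (fib i).card * ((i : ZeroIdx).val.re - 1 / 2) ^ 2 := by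
  by_contra hlt
  push Not at hlt
  have hm0 : (0 : ℝ) < (fib i).card := by exact_mod_cast fib_card_pos i
  have hp : (pairing N (classVec i) (classVec i)).re = -2 * (fib i).card := by
    rw [pairing_classVec hi]
    simp
  have hx : ∫ u in Icc (-1 : ℝ) 1, ‖F N (classVec i) u‖ ^ 2 < c * -(pairing N (classVec i) (classVec i)).re := by
    rw [hp]
    have hcost := cost_classVec_le i
    have h1 : 32 * ((fib i).card : ℝ) ^ 2 * ((i : ZeroIdx).val.re - 1 / 2) ^ 2 < c * -(-2 * ((fib i).card : ℝ)) := by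
      have h2 := mul_lt_mul_of_pos_left hlt (by positivity : (0 : ℝ) < 32 * (fib i).card)
      nlinarith [h2]
    exact hcost.trans_lt h1
  obtain ⟨μ, hμ, him, hlo, hhi⟩ := exists_negRoot_of_screening_mult one_pos hc (classVec_mem i) hx
  have := hB μ hμ him hhi
  linarith

/-- The number of slots of `ρ_i` inside `Γ_N` is at most the multiplicity `m(ρ_i)`. -/
theorem card_fib_le_order (i : truncIdx N) :
    ((fib i).card : ℝ) ≤ (riemannZetaZeroOrder (i : ZeroIdx).val : ℝ) := by
  have hle : (fib i).card ≤ (riemannZetaZeroOrder (i : ZeroIdx).val).toNat := by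
    calc (fib i).card
        ≤ (Finset.range (riemannZetaZeroOrder (i : ZeroIdx).val).toNat).card :=
          Finset.card_le_card_of_injOn (fun j : truncIdx N ↦ ((j : ZeroIdx).2 : ℕ)) (fun j hj ↦ by
            have hj' : j ∈ fib i := by simpa using hj
            have hv : ((j : ZeroIdx).1 : ℂ) = (i : ZeroIdx).val := mem_fib.1 hj'
            have hlt : (((j : ZeroIdx).2 : ℕ)) < (riemannZetaZeroOrder ((j : ZeroIdx).1 : ℂ)).toNat :=
              ((j : ZeroIdx).2).isLt
            have heq : (riemannZetaZeroOrder ((j : ZeroIdx).1 : ℂ)).toNat =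
                (riemannZetaZeroOrder (i : ZeroIdx).val).toNat := by rw [hv]
            rw [Finset.mem_coe, Finset.mem_range]
            exact hlt.trans_eq heq)
          (by
            intro j hj j' hj' hjj'
            have h1 : ((j : ZeroIdx).1 : ℂ) = ((j' : ZeroIdx).1 : ℂ) :=
              (mem_fib.1 (by simpa using hj)).trans (mem_fib.1 (by simpa using hj')).symm
            have h2 : (j : ZeroIdx).1 = (j' : ZeroIdx).1 := Subtype.ext h1
            exact Subtype.ext (Sigma.ext h2 ((Fin.heq_ext_iff (by rw [h2])).2 hjj')))
      _ = _ := Finset.card_range _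
  have hpos : 0 < (riemannZetaZeroOrder (i : ZeroIdx).val).toNat := Fin.pos (i : ZeroIdx).2
  have h0 : 0 ≤ riemannZetaZeroOrder (i : ZeroIdx).val := by omega
  calc ((fib i).card : ℝ) ≤ ((riemannZetaZeroOrder (i : ZeroIdx).val).toNat : ℝ) := by exact_mod_cast hle
    _ = (riemannZetaZeroOrder (i : ZeroIdx).val : ℝ) := by
        rw [← Int.cast_natCast, Int.toNat_of_nonneg h0]

/-- **`B′([−1,1])` ⟹ a zero-free region around the critical LINE (the line itself excepted):**
`(Re ρ − ½)² · log(|Im ρ| + 2) ≥ c′` for every off-line non-trivial zero — no simplicity hypothesis, via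
`m(ρ) ≤ C log(|γ| + 2)` (MV Thm 10.13, tree `exists_order_le_log`). [new] -/
theorem zeroFreeRegion_of_boundedAway (hB : TruncNegEigenvalueBoundedAway (Icc (-1 : ℝ) 1)) :
    ∃ c' : ℝ, 0 < c' ∧ ∀ ρ ∈ ZetaZeros.riemannZetaNontrivialZeros, ρ.re ≠ 1 / 2 →
      c' ≤ Real.log (|ρ.im| + 2) * (ρ.re - 1 / 2) ^ 2 := by
  obtain ⟨c, hc, N₀, hN₀⟩ := hB
  obtain ⟨C, hC, hord⟩ := Literature.NumberTheory.LFunctions.CramerMeanSquare.exists_order_le_log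
  refine ⟨c / (16 * C), by positivity, fun ρ hρ hre ↦ ?_⟩
  obtain ⟨i, hi⟩ := exists_slot hρ
  set N : ℕ := max N₀ ⌈‖i.val - 1 / 2‖⌉₊ with hN
  have hmem : i ∈ truncIdx N :=
    mem_truncIdx_of_le ((Nat.le_ceil _).trans (by exact_mod_cast le_max_right N₀ _))
  have hoff : i.OffLine := by
    show i.val.re ≠ 1 / 2
    rw [hi]; exact hre
  have hgap : c / 16 ≤ ((fib (⟨i, hmem⟩ : truncIdx N)).card : ℝ) * (i.val.re - 1 / 2) ^ 2 :=
    gap_of_boundedAway_level_mult hc (hN₀ N (le_max_left _ _)) ⟨i, hmem⟩ hoff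
  have hcard : ((fib (⟨i, hmem⟩ : truncIdx N)).card : ℝ) ≤ (riemannZetaZeroOrder i.val : ℝ) :=
    card_fib_le_order ⟨i, hmem⟩
  have hordi := hord i.val i.val_mem
  rw [hi] at hgap hcard hordi
  have hκ : 0 ≤ (ρ.re - 1 / 2) ^ 2 := sq_nonneg _
  have h1 : c / 16 ≤ C * Real.log (|ρ.im| + 2) * (ρ.re - 1 / 2) ^ 2 :=
    hgap.trans ((mul_le_mul_of_nonneg_right hcard hκ).trans (mul_le_mul_of_nonneg_right hordi hκ))
  rw [div_le_iff₀ (by positivity)]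
  nlinarith [h1, hC]

/-- **ES_m (eventual strip weighted by multiplicity).** For every `η > 0` only finitely many OFF-LINE zeros have
`m(ρ) · (Re ρ − ½)² ≥ η`. RH-implied (vacuously), implied by FOZ, compatible with infinitely many off-line zeros.
[new conjecture-shaped def; rh-split x-wuc g5] -/
@[conjecture] def EventualStripMult : Prop :=
  ∀ η : ℝ, 0 < η → {ρ : ℂ | ρ ∈ ZetaZeros.riemannZetaNontrivialZeros ∧ ρ.re ≠ 1 / 2 ∧
    η ≤ (riemannZetaZeroOrder ρ : ℝ) * (ρ.re - 1 / 2) ^ 2}.Finite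

/-- FOZ implies `EventualStripMult`. -/
theorem eventualStripMult_of_foz (h : CofiniteCriticalLine) : EventualStripMult := fun _ _ ↦
  (cofiniteCriticalLine_iff_foz.1 h).subset fun _ hρ ↦ ⟨hρ.1, hρ.2.1⟩

/-- RH implies `EventualStripMult` (RH-implied conjunct). -/
theorem eventualStripMult_of_rh (hRH : _root_.RiemannHypothesis) : EventualStripMult :=
  eventualStripMult_of_foz (cofiniteCriticalLine_of_rh hRH)

/-- `ES_m ∧ B′([−1,1]) ⟹ FOZ`, with NO simplicity hypothesis. [new] -/
theorem foz_of_eventualStripMult_of_boundedAway (hES : EventualStripMult)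
    (hB : TruncNegEigenvalueBoundedAway (Icc (-1 : ℝ) 1)) : CofiniteCriticalLine := by
  obtain ⟨c, hc, N₀, hN₀⟩ := hB
  refine cofiniteCriticalLine_iff_foz.2 ((hES (c / 16) (by positivity)).subset fun ρ hρ ↦ ⟨hρ.1, hρ.2, ?_⟩)
  obtain ⟨i, hi⟩ := exists_slot hρ.1
  set N : ℕ := max N₀ ⌈‖i.val - 1 / 2‖⌉₊ with hN
  have hmem : i ∈ truncIdx N :=
    mem_truncIdx_of_le ((Nat.le_ceil _).trans (by exact_mod_cast le_max_right N₀ _))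
  have hoff : i.OffLine := by
    show i.val.re ≠ 1 / 2
    rw [hi]; exact hρ.2
  have hgap : c / 16 ≤ ((fib (⟨i, hmem⟩ : truncIdx N)).card : ℝ) * (i.val.re - 1 / 2) ^ 2 :=
    gap_of_boundedAway_level_mult hc (hN₀ N (le_max_left _ _)) ⟨i, hmem⟩ hoff
  have hcard : ((fib (⟨i, hmem⟩ : truncIdx N)).card : ℝ) ≤ (riemannZetaZeroOrder i.val : ℝ) :=
    card_fib_le_order ⟨i, hmem⟩
  rw [hi] at hgap hcard
  exact hgap.trans (mul_le_mul_of_nonneg_right hcard (sq_nonneg _))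

/-- Row X-5 direction with the C5 implication `FOZ → B′([−1,1]) → RH` as an explicit hypothesis:
`EventualStripMult ∧ B′([−1,1]) ⟹ RH` (conditional bookkeeping; nothing here asserts RH). -/
theorem rh_of_eventualStripMult_of_boundedAway
    (hC5 : CofiniteCriticalLine → TruncNegEigenvalueBoundedAway (Icc (-1) 1) → _root_.RiemannHypothesis)
    (hES : EventualStripMult) (hB : TruncNegEigenvalueBoundedAway (Icc (-1) 1)) : _root_.RiemannHypothesis :=
  hC5 (foz_of_eventualStripMult_of_boundedAway hES hB) hB

/-- **Row X-5 (kernel, modulo row C5 and `RH → B′`; NO simplicity / Gram hypothesis):**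
`RH ⟺ ES_m ∧ B′([−1,1])`. [new-combination] -/
theorem rh_iff_eventualStripMult_and_boundedAway
    (hC5 : CofiniteCriticalLine → TruncNegEigenvalueBoundedAway (Icc (-1) 1) → _root_.RiemannHypothesis)
    (hBrh : _root_.RiemannHypothesis → TruncNegEigenvalueBoundedAway (Icc (-1) 1)) :
    _root_.RiemannHypothesis ↔ EventualStripMult ∧ TruncNegEigenvalueBoundedAway (Icc (-1) 1) :=
  ⟨fun h ↦ ⟨eventualStripMult_of_rh h, hBrh h⟩, fun h ↦ rh_of_eventualStripMult_of_boundedAway hC5 h.1 h.2⟩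

/-! ## §13 Rows X-5 / X-5s modulo the ONE named print fact of row C5
(tree `Splittings.BombieriCorollaryProvenance`, p498170: `Corollary11Prov` in hypothesis position; `RH → B′` is
its unconditional §3) — same standing as row C5 `rh_iff_foz_and_boundedAway_one (h : Corollary11Prov)`. -/

open Summit.RiemannHypothesis.RiemannHypothesis.Theorems.Splittings.BombieriCorollaryProvenance in
/-- **Row X-5 of record.** Modulo Bombieri's Corollary-with-provenance (the named print fact of row C5),
`RH ⟺ ES_m ∧ B′([−1,1])`: FOZ replaced by the strictly weaker multiplicity-weighted eventual strip `ES_m`,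
NO simplicity hypothesis. [new-combination] -/
theorem rh_iff_eventualStripMult_and_boundedAway_prov (h : Corollary11Prov) :
    _root_.RiemannHypothesis ↔ EventualStripMult ∧ TruncNegEigenvalueBoundedAway (Icc (-1) 1) :=
  rh_iff_eventualStripMult_and_boundedAway (fun hfoz hB ↦ rh_of_foz_of_boundedAway_one h hfoz hB)
    (fun hRH ↦ truncNegEigenvalueBoundedAway_Icc_of_rh hRH 1)

open Summit.RiemannHypothesis.RiemannHypothesis.Theorems.Splittings.BombieriCorollaryProvenance in
/-- GIVEN `ES_m`, Bombieri's question on `[−1,1]` and RH coincide modulo the named fact (`A → (B ↔ RH)` shape;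
not `B′ ↔ RH` outright). [new-but-trivial] -/
theorem boundedAway_one_iff_rh_of_eventualStripMult (h : Corollary11Prov) (hES : EventualStripMult) :
    TruncNegEigenvalueBoundedAway (Icc (-1) 1) ↔ _root_.RiemannHypothesis :=
  ⟨fun hB ↦ (rh_iff_eventualStripMult_and_boundedAway_prov h).2 ⟨hES, hB⟩,
    fun hRH ↦ truncNegEigenvalueBoundedAway_Icc_of_rh hRH 1⟩

end Summit.RiemannHypothesis.RiemannHypothesis.Theorems.Splittings.BombieriTruncEventualStrip
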